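import Mathlib.MeasureTheory.Measure.SeparableMeasure
import Literature.Analysis.OperatorTheory.KernelIterateBridge
import Literature.Analysis.OperatorTheory.KernelPathIntegralPeeling
import Literature.Analysis.OperatorTheory.HeterogeneousCyclicPeeling
import HarnessLib

/-!
# The `r+1`-step path kernel of a transfer kernel and kernel domination of bond operators — PROVED

Topic `Literature/Analysis/OperatorTheory`; companion of `KernelPathIntegralPeeling.lean` (open blocks: peeling the path
weight `W(u, v) = ∏ᵢ K((u ∷ v)ᵢ, vᵢ)` gives iterates of the pointwise transfer operator
`(κ f)(x) = ∫ K(x, y) f(y) dμ(y)`), `HeterogeneousCyclicPeeling.lean` (block contraction: a slab weight of `r + 2`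
consecutive sites integrates out to the bond kernel `X̂(u, u') = ∫ Ψ(u ∷ v :: u') dμ^{⊗r}(v)`),
`KernelIterateBridge.lean` (`A^j [h] =ᵐ κ^[j] h` for the `L²` operator `A` of `K`) and
`PositiveKernelTransferOperator.lean` (`exists_kernelOp`, `inner_kernelOp_eq_integral`).  For a bounded measurable kernel
`K` on a probability space `(X, μ)` the CLOSED block weight with both end points prescribed contracts to the
`r+1`-STEP PATH KERNEL

  `P_r(u, u') = ∫ ∏_{i : Fin (r+1)} K((u ∷ v :: u')ᵢ, (u ∷ v :: u')ᵢ₊₁) dμ^{⊗r}(v)`   (`u ∷ v :: u' = Fin.cons u (Fin.snoc v u')`),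

the shape in which block contraction delivers the dominating kernel of a slab observable of time-width `r + 1` bonds
(`|X̂(u, u')| ≤ ‖Ψ‖_∞ P_r(u, u')`).  This file PROVES (no definitions; `P_r` and `κ` are written out):

* `prod_cons_snoc`, `pathKernel_eq` — `P_r(u, y) = ∫ W(u, v) K((u ∷ v)_{last}, y) dμ^{⊗r}(v)` (Fin bookkeeping);
* `measurable_closedPathWeight`, `measurable_pathKernel`, `norm_pathKernel_le`, `pathKernel_pos` — `P_r` is jointly
  measurable, `|P_r| ≤ C^{r+1}`, and `0 < P_r` for a strictly positive kernel;
* `pathKernel_succ` — one-step peeling `P_{r+1}(u, y) = ∫ K(u, y') P_r(y', y) dμ(y')`;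
* `integral_pathKernel_mul` (**main identity**) — `∫ P_r(u, y) h(y) dμ(y) = (κ^[r+1] h)(u)` for bounded measurable `h`:
  `P_r` is the kernel of `κ^{r+1}` (induction on `r`, `integral_kernel_mul_integral_kernel_mul`);
* `norm_kernelOp_le_of_abs_le_pathKernel` (**kernel domination**) — if the kernel `X` of an `L²` operator `𝒳` satisfies
  `|X| ≤ C_A P_r` with `0 ≤ C_A`, then `‖𝒳‖ ≤ C_A ‖A‖^{r+1}`: on simple functions
  `|⟪ψ, 𝒳 φ⟫| ≤ C_A ∫ |ψ| κ^[r+1]|φ| = C_A ⟪|ψ|, A^{r+1} |φ|⟫ ≤ C_A ‖A‖^{r+1} ‖ψ‖ ‖φ‖`, then density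
  (`Lp.simpleFunc.denseRange`);
* `inner_kernelOp_self_nonneg` — POSITIVE TYPE passes to `L²`: `∬ f K f ≥ 0` for measurable `|f| ≤ 1` gives
  `0 ≤ ⟪φ, A φ⟫` for all `φ ∈ L²` (rescaling, density, continuity) — hence non-negative eigenvalues;
* `exists_index_eq_norm` — if `‖T‖` is an eigenvalue of a self-adjoint `T` with a Hilbert basis of eigenvectors
  `T bᵢ = λᵢ bᵢ`, then `‖T‖ = λᵢ` for some `i`;
* `limsup_rpow_eq_of_hasSum_pow` — growth rate of the traces: `Z(n+1) = Σᵢ λᵢ^{n+2}`, `0 ≤ λᵢ ≤ λ_{i₀}`,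
  `0 < λ_{i₀}`, `Σ λᵢ² < ∞` give `limsup_m Z(m)^{1/(m+1)} = λ_{i₀}` (`λ_{i₀}^{n+2} ≤ Z(n+1) ≤ λ_{i₀}^n Σ λᵢ²`).

These are the abstract inputs of the transfer-matrix representation of time-sliced lattice models with bond
insertions (route `QuantumFields/PencilRigidity`, crux `WeakCouplingHypercubicLimit`, stub `stub_spectralData`).
References: M. Reed, B. Simon, *Methods of Modern Mathematical Physics I* (1980), §VI.5–VI.6 (Thm. VI.16,
VI.22–23); B. Simon, *The Statistical Mechanics of Lattice Gases I* (1993), §II.4 (transfer matrices). [folklore]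
Tree search (`lean search 'Fin.cons u \(Fin.snoc|norm_kernelOp_le|inner_kernelOp.*nonneg|limsup.*rpow'`): only the
open-block peeling of `KernelPathIntegralPeeling`, the slab contraction / reversal lemmas of `HeterogeneousCyclicPeeling`
(which produce `P_r`'s shape but do not identify it with `κ^{r+1}`), and unrelated automorphic `norm_kernelOp_le_of_*`.
-/

noncomputable section

open scoped BigOperators Topology InnerProductSpace ENNReal
open MeasureTheory Filter Set Function

namespace Literature.Analysis.OperatorTheory

/-! ### The `r+1`-step path kernel -/

section PathKernel

variable {X : Type*} [MeasurableSpace X] {μ : Measure X}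

omit [MeasurableSpace X] in
/-- Bond product of the closed block `u ∷ v :: y`: the open path weight of `u ∷ v` times the last bond
`K((u ∷ v)_{last}, y)`. [folklore] -/
theorem prod_cons_snoc (K : X → X → ℝ) (r : ℕ) (u y : X) (v : Fin r → X) :
    ∏ i : Fin (r + 1), K ((Fin.cons u (Fin.snoc v y) : Fin (r + 2) → X) (Fin.castSucc i))
        ((Fin.cons u (Fin.snoc v y) : Fin (r + 2) → X) (Fin.succ i)) =
      (∏ i : Fin r, K ((Fin.cons u v : Fin (r + 1) → X) (Fin.castSucc i)) (v i)) *
        K ((Fin.cons u v : Fin (r + 1) → X) (Fin.last r)) y := by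
  simp only [Fin.cons_succ]
  rw [Fin.cons_snoc_eq_snoc_cons]
  simp only [Fin.snoc_castSucc]
  rw [Fin.prod_univ_castSucc, Fin.snoc_last]
  simp only [Fin.snoc_castSucc]

/-- The path kernel as a peeled block integral: `P_r(u, y) = ∫ W(u, v) K((u ∷ v)_{last}, y) dμ^{⊗r}(v)` with the open
path weight `W(u, v) = ∏ᵢ K((u ∷ v)ᵢ, vᵢ)` of `KernelPathIntegralPeeling`. [folklore] -/
theorem pathKernel_eq (K : X → X → ℝ) (r : ℕ) (u y : X) :
    (∫ v : Fin r → X, ∏ i : Fin (r + 1), K ((Fin.cons u (Fin.snoc v y) : Fin (r + 2) → X) (Fin.castSucc i))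
        ((Fin.cons u (Fin.snoc v y) : Fin (r + 2) → X) (Fin.succ i)) ∂(Measure.pi fun _ => μ)) =
      ∫ v : Fin r → X, (∏ i : Fin r, K ((Fin.cons u v : Fin (r + 1) → X) (Fin.castSucc i)) (v i)) *
        K ((Fin.cons u v : Fin (r + 1) → X) (Fin.last r)) y ∂(Measure.pi fun _ => μ) :=
  integral_congr_ae (Eventually.of_forall fun v => prod_cons_snoc K r u y v)

variable {K : X → X → ℝ} {C : ℝ}

/-- The bond product of the closed block is jointly measurable in the end points and the interior. [folklore] -/
theorem measurable_closedPathWeight (hK : Measurable (uncurry K)) (r : ℕ) :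
    Measurable fun q : (X × X) × (Fin r → X) => ∏ i : Fin (r + 1),
      K ((Fin.cons q.1.1 (Fin.snoc q.2 q.1.2) : Fin (r + 2) → X) (Fin.castSucc i))
        ((Fin.cons q.1.1 (Fin.snoc q.2 q.1.2) : Fin (r + 2) → X) (Fin.succ i)) := by
  have hc : Measurable fun q : (X × X) × (Fin r → X) =>
      (Fin.cons q.1.1 (Fin.snoc q.2 q.1.2) : Fin (r + 2) → X) :=
    (measurable_finCons (r + 1)).comp
      (measurable_fst.fst.prodMk ((measurable_finSnoc r).comp (measurable_snd.prodMk measurable_fst.snd)))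
  refine Finset.measurable_prod _ fun i _ => ?_
  have h1 : Measurable fun q : (X × X) × (Fin r → X) =>
      (Fin.cons q.1.1 (Fin.snoc q.2 q.1.2) : Fin (r + 2) → X) (Fin.castSucc i) := (measurable_pi_apply _).comp hc
  have h2 : Measurable fun q : (X × X) × (Fin r → X) =>
      (Fin.cons q.1.1 (Fin.snoc q.2 q.1.2) : Fin (r + 2) → X) (Fin.succ i) := (measurable_pi_apply _).comp hc
  exact hK.comp (h1.prodMk h2)

variable [IsProbabilityMeasure μ]

/-- The path kernel `P_r(u, y)` is jointly measurable. [folklore] -/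
theorem measurable_pathKernel (hK : Measurable (uncurry K)) (r : ℕ) :
    Measurable (uncurry fun u y : X => ∫ v : Fin r → X, ∏ i : Fin (r + 1),
      K ((Fin.cons u (Fin.snoc v y) : Fin (r + 2) → X) (Fin.castSucc i))
        ((Fin.cons u (Fin.snoc v y) : Fin (r + 2) → X) (Fin.succ i)) ∂(Measure.pi fun _ => μ)) :=
  ((measurable_closedPathWeight hK r).stronglyMeasurable.integral_prod_right'
    (ν := Measure.pi fun _ : Fin r => μ)).measurable

/-- `|P_r(u, y)| ≤ C^{r+1}` when `|K| ≤ C` (probability measure). [folklore] -/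
theorem norm_pathKernel_le (hC : ∀ x y, ‖K x y‖ ≤ C) (r : ℕ) (u y : X) :
    ‖∫ v : Fin r → X, ∏ i : Fin (r + 1), K ((Fin.cons u (Fin.snoc v y) : Fin (r + 2) → X) (Fin.castSucc i))
        ((Fin.cons u (Fin.snoc v y) : Fin (r + 2) → X) (Fin.succ i)) ∂(Measure.pi fun _ => μ)‖ ≤ C ^ (r + 1) := by
  have h : ∀ v : Fin r → X, ‖∏ i : Fin (r + 1), K ((Fin.cons u (Fin.snoc v y) : Fin (r + 2) → X) (Fin.castSucc i))
      ((Fin.cons u (Fin.snoc v y) : Fin (r + 2) → X) (Fin.succ i))‖ ≤ C ^ (r + 1) := fun v =>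
    calc _ ≤ ∏ i : Fin (r + 1), ‖K ((Fin.cons u (Fin.snoc v y) : Fin (r + 2) → X) (Fin.castSucc i))
          ((Fin.cons u (Fin.snoc v y) : Fin (r + 2) → X) (Fin.succ i))‖ := Finset.norm_prod_le _ _
      _ ≤ ∏ _i : Fin (r + 1), C := Finset.prod_le_prod (fun i _ => norm_nonneg _) fun i _ => hC _ _
      _ = C ^ (r + 1) := by simp
  calc _ ≤ C ^ (r + 1) * (Measure.pi fun _ : Fin r => μ).real univ :=
        norm_integral_le_of_norm_le_const (Eventually.of_forall h)
    _ = C ^ (r + 1) := by rw [probReal_univ, mul_one]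

/-- `0 < P_r(u, y)` for a strictly positive kernel (probability measure). [folklore] -/
theorem pathKernel_pos (hK : Measurable (uncurry K)) (hC : ∀ x y, ‖K x y‖ ≤ C) (hpos : ∀ x y, 0 < K x y)
    (r : ℕ) (u y : X) :
    0 < ∫ v : Fin r → X, ∏ i : Fin (r + 1), K ((Fin.cons u (Fin.snoc v y) : Fin (r + 2) → X) (Fin.castSucc i))
        ((Fin.cons u (Fin.snoc v y) : Fin (r + 2) → X) (Fin.succ i)) ∂(Measure.pi fun _ => μ) := by
  set F : (Fin r → X) → ℝ := fun v => ∏ i : Fin (r + 1),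
    K ((Fin.cons u (Fin.snoc v y) : Fin (r + 2) → X) (Fin.castSucc i))
      ((Fin.cons u (Fin.snoc v y) : Fin (r + 2) → X) (Fin.succ i)) with hF
  have hq : Measurable fun v : Fin r → X => ((u, y), v) := measurable_const.prodMk measurable_id
  have hFm : Measurable F := (measurable_closedPathWeight hK r).comp hq
  have hFp : ∀ v, 0 < F v := fun v => Finset.prod_pos fun i _ => hpos _ _
  have hC0 : 0 ≤ C := (norm_nonneg _).trans (hC u u)
  have hFb : ∀ v, ‖F v‖ ≤ C ^ (r + 1) := fun v =>
    calc ‖F v‖ ≤ ∏ i : Fin (r + 1), ‖K ((Fin.cons u (Fin.snoc v y) : Fin (r + 2) → X) (Fin.castSucc i))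
          ((Fin.cons u (Fin.snoc v y) : Fin (r + 2) → X) (Fin.succ i))‖ := Finset.norm_prod_le _ _
      _ ≤ ∏ _i : Fin (r + 1), C := Finset.prod_le_prod (fun i _ => norm_nonneg _) fun i _ => hC _ _
      _ = C ^ (r + 1) := by simp
  have hint : Integrable F (Measure.pi fun _ => μ) :=
    Integrable.of_bound hFm.aestronglyMeasurable (C ^ (r + 1)) (Eventually.of_forall hFb)
  have hsupp : support F = univ := eq_univ_of_forall fun v => (hFp v).ne'
  rw [integral_pos_iff_support_of_nonneg (fun v => (hFp v).le) hint, hsupp, measure_univ]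
  exact one_pos

/-- **One-step peeling of the path kernel**: `P_{r+1}(u, y) = ∫ K(u, y') P_r(y', y) dμ(y')`
(`KernelPathIntegralPeeling.integral_pathWeight_succ_eq`). [folklore] -/
theorem pathKernel_succ (hK : Measurable (uncurry K)) (hC : ∀ x y, ‖K x y‖ ≤ C) (r : ℕ) (u y : X) :
    (∫ v : Fin (r + 1) → X, ∏ i : Fin (r + 1 + 1),
        K ((Fin.cons u (Fin.snoc v y) : Fin (r + 1 + 2) → X) (Fin.castSucc i))
          ((Fin.cons u (Fin.snoc v y) : Fin (r + 1 + 2) → X) (Fin.succ i)) ∂(Measure.pi fun _ => μ)) =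
      ∫ y', K u y' * ∫ v : Fin r → X, ∏ i : Fin (r + 1),
        K ((Fin.cons y' (Fin.snoc v y) : Fin (r + 2) → X) (Fin.castSucc i))
          ((Fin.cons y' (Fin.snoc v y) : Fin (r + 2) → X) (Fin.succ i)) ∂(Measure.pi fun _ => μ) ∂μ := by
  rw [pathKernel_eq K (r + 1) u y]
  have hlast : ∀ v : Fin (r + 1) → X, (Fin.cons u v : Fin (r + 2) → X) (Fin.last (r + 1)) = v (Fin.last r) :=
    fun v => by rw [← Fin.succ_last, Fin.cons_succ]
  simp_rw [hlast]
  have hq : Measurable fun v : Fin (r + 1) → X => (v (Fin.last r), y) :=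
    (measurable_pi_apply _).prodMk measurable_const
  rw [integral_pathWeight_succ_eq (ρ := μ) hK hC r u (F := fun v : Fin (r + 1) → X => K (v (Fin.last r)) y)
    (hK.comp hq) (B := C) (fun v => hC _ _)]
  refine integral_congr_ae (Eventually.of_forall fun y' => ?_)
  dsimp only
  rw [pathKernel_eq K r y' y]

/-- **The path kernel is the kernel of the `(r+1)`-st iterate of the pointwise transfer operator**:
`∫ P_r(u, y) h(y) dμ(y) = (κ^[r+1] h)(u)` for bounded measurable `h`, `(κ f)(x) = ∫ K(x, y) f(y) dμ(y)`
(induction on `r`: peeling and Fubini, `integral_kernel_mul_integral_kernel_mul`). [folklore] -/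
theorem integral_pathKernel_mul (hK : Measurable (uncurry K)) (hC : ∀ x y, ‖K x y‖ ≤ C) (r : ℕ) {h : X → ℝ}
    (hh : Measurable h) {B : ℝ} (hhb : ∀ x, ‖h x‖ ≤ B) (u : X) :
    ∫ y, (∫ v : Fin r → X, ∏ i : Fin (r + 1), K ((Fin.cons u (Fin.snoc v y) : Fin (r + 2) → X) (Fin.castSucc i))
        ((Fin.cons u (Fin.snoc v y) : Fin (r + 2) → X) (Fin.succ i)) ∂(Measure.pi fun _ => μ)) * h y ∂μ =
      ((fun f : X → ℝ => fun x => ∫ y, K x y * f y ∂μ)^[r + 1] h) u := by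
  induction r generalizing u with
  | zero =>
    rw [Function.iterate_one]
    refine integral_congr_ae (Eventually.of_forall fun y => ?_)
    dsimp only
    rw [pathKernel_eq K 0 u y]
    simp [integral_const, probReal_univ]
  | succ r ih =>
    rw [Function.iterate_succ_apply']
    simp_rw [pathKernel_succ hK hC r]
    rw [← integral_kernel_mul_integral_kernel_mul hK (measurable_pathKernel hK r) hC (norm_pathKernel_le hC r)
      hh hhb u]
    refine integral_congr_ae (Eventually.of_forall fun y' => ?_)
    dsimp only
    rw [ih y']

end PathKernel

/-! ### Kernel domination of the operator norm -/

section NormBound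

variable {X : Type*} [MeasurableSpace X] {μ : Measure X} [IsProbabilityMeasure μ] {K : X → X → ℝ} {C : ℝ}
  {A : Lp ℝ 2 μ →L[ℝ] Lp ℝ 2 μ}

/-- **Kernel domination bounds the operator norm.**  If the kernel `X` of the `L²` operator `𝒳` is dominated by
`C_A` times the `r+1`-step path kernel of `K`, `|X(u,u')| ≤ C_A P_r(u,u')`, then `‖𝒳‖ ≤ C_A ‖A‖^{r+1}` where `A` is the
`L²` operator of `K`: on simple functions
`|⟪ψ, 𝒳φ⟫| ≤ C_A ∫ |ψ| κ^[r+1]|φ| = C_A ⟪|ψ|, A^{r+1}|φ|⟫ ≤ C_A ‖A‖^{r+1} ‖ψ‖ ‖φ‖`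
(`integral_pathKernel_mul`, `pow_kernelOp_toLp_ae_eq_iterate`), then density of simple functions in `L²`.
[folklore] -/
theorem norm_kernelOp_le_of_abs_le_pathKernel (hK : StronglyMeasurable (uncurry K)) (hC : ∀ x y, ‖K x y‖ ≤ C)
    (hA : ∀ φ : Lp ℝ 2 μ, (A φ : X → ℝ) =ᵐ[μ] fun x => ∫ y, K x y * φ y ∂μ)
    {Xk : X → X → ℝ} {Xop : Lp ℝ 2 μ →L[ℝ] Lp ℝ 2 μ}
    (hXop : ∀ φ : Lp ℝ 2 μ, (Xop φ : X → ℝ) =ᵐ[μ] fun x => ∫ y, Xk x y * φ y ∂μ) (r : ℕ) {CA : ℝ} (hCA : 0 ≤ CA)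
    (hdom : ∀ u u' : X, |Xk u u'| ≤ CA * (∫ v : Fin r → X, ∏ i : Fin (r + 1),
      K ((Fin.cons u (Fin.snoc v u') : Fin (r + 2) → X) (Fin.castSucc i))
        ((Fin.cons u (Fin.snoc v u') : Fin (r + 2) → X) (Fin.succ i)) ∂(Measure.pi fun _ => μ))) :
    ‖Xop‖ ≤ CA * ‖A‖ ^ (r + 1) := by
  have hd := Lp.simpleFunc.denseRange (E := ℝ) (p := (2 : ℝ≥0∞)) (μ := μ) ENNReal.ofNat_ne_top
  have hKm : Measurable (uncurry K) := hK.measurable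
  set M : ℝ := CA * ‖A‖ ^ (r + 1) with hM
  have hM0 : 0 ≤ M := by positivity
  -- (1) the bilinear bound on simple functions
  have h1 : ∀ ψ φ : Lp.simpleFunc ℝ 2 μ,
      |⟪(ψ : Lp ℝ 2 μ), Xop (φ : Lp ℝ 2 μ)⟫_ℝ| ≤ M * ‖(ψ : Lp ℝ 2 μ)‖ * ‖(φ : Lp ℝ 2 μ)‖ := by
    intro ψ φ
    set f := Lp.simpleFunc.toSimpleFunc ψ with hf_def
    set g := Lp.simpleFunc.toSimpleFunc φ with hg_def
    have hf : (f : X → ℝ) =ᵐ[μ] ((ψ : Lp ℝ 2 μ) : X → ℝ) := Lp.simpleFunc.toSimpleFunc_eq_toFun ψ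
    have hg : (g : X → ℝ) =ᵐ[μ] ((φ : Lp ℝ 2 μ) : X → ℝ) := Lp.simpleFunc.toSimpleFunc_eq_toFun φ
    obtain ⟨Bf, hBf⟩ := f.exists_forall_norm_le
    obtain ⟨Bg, hBg⟩ := g.exists_forall_norm_le
    -- `|g|` is bounded measurable and its class is `|φ|`
    have hgam : Measurable fun x => |g x| := continuous_abs.measurable.comp g.measurable
    have hgab : ∀ x, ‖|g x|‖ ≤ Bg := fun x => by
      rw [Real.norm_eq_abs, abs_abs, ← Real.norm_eq_abs]; exact hBg x
    have hcl : (memLp_two_of_bound (μ := μ) hgam hgab).toLp _ = |(φ : Lp ℝ 2 μ)| :=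
      Lp.ext ((MemLp.coeFn_toLp _).trans (by
        filter_upwards [Lp.coeFn_abs (φ : Lp ℝ 2 μ), hg] with x hx hgx
        rw [hx, ← hgx]))
    -- the iterate `G = κ^[r+1] |g|` represents `A^{r+1} |φ|`
    set G : X → ℝ := (fun f : X → ℝ => fun x => ∫ y, K x y * f y ∂μ)^[r + 1] fun x => |g x| with hG
    have hGae : (((A ^ (r + 1)) |(φ : Lp ℝ 2 μ)| : Lp ℝ 2 μ) : X → ℝ) =ᵐ[μ] G := by
      rw [← hcl]; exact pow_kernelOp_toLp_ae_eq_iterate hA hgam hgab (r + 1)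
    obtain ⟨⟨BG, hBG⟩, hGm⟩ := exists_bound_and_measurable_kernelIterate (μ := μ) hK hC hgam ⟨Bg, hgab⟩ (r + 1)
    -- inner estimate `|∫ X(x,y) g(y)| ≤ CA G(x)`
    have hin : ∀ x, |∫ y, Xk x y * g y ∂μ| ≤ CA * G x := by
      intro x
      have hC0 : 0 ≤ C := (norm_nonneg _).trans (hC x x)
      have hPm := (measurable_pathKernel (μ := μ) hKm r).of_uncurry_left (x := x)
      calc |∫ y, Xk x y * g y ∂μ| ≤ ∫ y, |Xk x y * g y| ∂μ := abs_integral_le_integral_abs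
        _ ≤ ∫ y, CA * ((∫ v : Fin r → X, ∏ i : Fin (r + 1),
              K ((Fin.cons x (Fin.snoc v y) : Fin (r + 2) → X) (Fin.castSucc i))
                ((Fin.cons x (Fin.snoc v y) : Fin (r + 2) → X) (Fin.succ i)) ∂(Measure.pi fun _ => μ)) * |g y|) ∂μ := by
            refine integral_mono_of_nonneg (Eventually.of_forall fun y => abs_nonneg _) ?_
              (Eventually.of_forall fun y => ?_)
            · refine (Integrable.of_bound (hPm.mul hgam).aestronglyMeasurable (C ^ (r + 1) * Bg)
                (Eventually.of_forall fun y => ?_)).const_mul CA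
              rw [Pi.mul_apply, norm_mul]
              exact mul_le_mul (norm_pathKernel_le hC r x y) (hgab y) (norm_nonneg _) (by positivity)
            · dsimp only
              rw [abs_mul, ← mul_assoc]
              exact mul_le_mul_of_nonneg_right (hdom x y) (abs_nonneg _)
        _ = CA * G x := by
            rw [integral_const_mul, integral_pathKernel_mul hKm hC r hgam hgab x]
    -- the two identifications
    have heq : ⟪(ψ : Lp ℝ 2 μ), Xop (φ : Lp ℝ 2 μ)⟫_ℝ = ∫ x, f x * ∫ y, Xk x y * g y ∂μ ∂μ := by
      rw [inner_kernelOp_eq_integral hXop]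
      refine integral_congr_ae ?_
      filter_upwards [hf] with x hx
      rw [← hx]
      congr 1
      exact integral_congr_ae (by filter_upwards [hg] with y hy; rw [hy])
    have habs : ∫ x, |f x| * G x ∂μ = ⟪|(ψ : Lp ℝ 2 μ)|, (A ^ (r + 1)) |(φ : Lp ℝ 2 μ)|⟫_ℝ := by
      rw [inner_eq_integral]
      refine integral_congr_ae ?_
      filter_upwards [Lp.coeFn_abs (ψ : Lp ℝ 2 μ), hf, hGae] with x hx hfx hGx
      rw [hx, hGx, ← hfx]
    -- assemble
    rw [heq]
    calc |∫ x, f x * ∫ y, Xk x y * g y ∂μ ∂μ|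
        ≤ ∫ x, |f x * ∫ y, Xk x y * g y ∂μ| ∂μ := abs_integral_le_integral_abs
      _ ≤ ∫ x, |f x| * (CA * G x) ∂μ := by
          refine integral_mono_of_nonneg (Eventually.of_forall fun x => abs_nonneg _) ?_
            (Eventually.of_forall fun x => ?_)
          · refine Integrable.of_bound ((continuous_abs.measurable.comp f.measurable).mul
              (hGm.measurable.const_mul CA)).aestronglyMeasurable (Bf * (‖CA‖ * BG))
              (Eventually.of_forall fun x => ?_)
            rw [norm_mul, norm_mul]
            refine mul_le_mul ?_ (mul_le_mul_of_nonneg_left (hBG x) (norm_nonneg _)) (by positivity)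
              ((norm_nonneg _).trans (hBf x))
            rw [Real.norm_eq_abs, abs_abs, ← Real.norm_eq_abs]; exact hBf x
          · dsimp only
            rw [abs_mul]
            exact mul_le_mul_of_nonneg_left (hin x) (abs_nonneg _)
      _ = CA * ∫ x, |f x| * G x ∂μ := by
          rw [← integral_const_mul]
          exact integral_congr_ae (Eventually.of_forall fun x => by ring)
      _ = CA * ⟪|(ψ : Lp ℝ 2 μ)|, (A ^ (r + 1)) |(φ : Lp ℝ 2 μ)|⟫_ℝ := by rw [habs]
      _ ≤ CA * (‖(ψ : Lp ℝ 2 μ)‖ * (‖A‖ ^ (r + 1) * ‖(φ : Lp ℝ 2 μ)‖)) := by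
          refine mul_le_mul_of_nonneg_left ?_ hCA
          calc ⟪|(ψ : Lp ℝ 2 μ)|, (A ^ (r + 1)) |(φ : Lp ℝ 2 μ)|⟫_ℝ
              ≤ ‖|(ψ : Lp ℝ 2 μ)|‖ * ‖(A ^ (r + 1)) |(φ : Lp ℝ 2 μ)|‖ := real_inner_le_norm _ _
            _ ≤ ‖|(ψ : Lp ℝ 2 μ)|‖ * (‖A ^ (r + 1)‖ * ‖|(φ : Lp ℝ 2 μ)|‖) :=
                mul_le_mul_of_nonneg_left ((A ^ (r + 1)).le_opNorm _) (norm_nonneg _)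
            _ ≤ ‖(ψ : Lp ℝ 2 μ)‖ * (‖A‖ ^ (r + 1) * ‖(φ : Lp ℝ 2 μ)‖) := by
                rw [norm_abs_eq_norm, norm_abs_eq_norm]
                exact mul_le_mul_of_nonneg_left (mul_le_mul_of_nonneg_right (norm_pow_le' _ (Nat.succ_pos r))
                  (norm_nonneg _)) (norm_nonneg _)
      _ = M * ‖(ψ : Lp ℝ 2 μ)‖ * ‖(φ : Lp ℝ 2 μ)‖ := by rw [hM]; ring
  -- (2) all of `L²` by density
  have h2 : ∀ ψ φ : Lp ℝ 2 μ, |⟪ψ, Xop φ⟫_ℝ| ≤ M * ‖ψ‖ * ‖φ‖ := by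
    intro ψ φ
    refine hd.induction_on (p := fun φ => |⟪ψ, Xop φ⟫_ℝ| ≤ M * ‖ψ‖ * ‖φ‖) φ
      (isClosed_le (continuous_abs.comp (continuous_const.inner Xop.continuous))
        (continuous_const.mul continuous_norm)) fun φs => ?_
    exact hd.induction_on (p := fun ψ => |⟪ψ, Xop (φs : Lp ℝ 2 μ)⟫_ℝ| ≤ M * ‖ψ‖ * ‖(φs : Lp ℝ 2 μ)‖) ψ
      (isClosed_le (continuous_abs.comp (continuous_id.inner continuous_const))
        ((continuous_const.mul continuous_norm).mul continuous_const)) fun ψs => h1 ψs φs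
  -- (3) the operator norm
  refine ContinuousLinearMap.opNorm_le_bound _ hM0 fun φ => ?_
  have h := h2 (Xop φ) φ
  rw [real_inner_self_eq_norm_sq, abs_of_nonneg (sq_nonneg _), sq] at h
  by_cases h0 : ‖Xop φ‖ = 0
  · rw [h0]; positivity
  · exact le_of_mul_le_mul_left (h.trans_eq (by ring)) (lt_of_le_of_ne (norm_nonneg _) (Ne.symm h0))

end NormBound

/-! ### Positive type passes to `L²` -/

section PositiveType

variable {X : Type*} [MeasurableSpace X] {μ : Measure X} {K : X → X → ℝ} {A : Lp ℝ 2 μ →L[ℝ] Lp ℝ 2 μ}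

/-- **Positive type passes to `L²`.**  If `∬ f(x) K(x,y) f(y) ≥ 0` for every measurable `|f| ≤ 1`, then the `L²`
operator `A` of `K` satisfies `0 ≤ ⟪φ, Aφ⟫` for every `φ ∈ L²` (rescaling removes the bound `1`; simple functions are
dense in `L²` and `φ ↦ ⟪φ, Aφ⟫` is continuous). [folklore] -/
theorem inner_kernelOp_self_nonneg (hA : ∀ φ : Lp ℝ 2 μ, (A φ : X → ℝ) =ᵐ[μ] fun x => ∫ y, K x y * φ y ∂μ)
    (hpt : ∀ f : X → ℝ, Measurable f → (∀ x, |f x| ≤ 1) → 0 ≤ ∫ x, ∫ y, f x * K x y * f y ∂μ ∂μ)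
    (φ : Lp ℝ 2 μ) : 0 ≤ ⟪φ, A φ⟫_ℝ := by
  have hd := Lp.simpleFunc.denseRange (E := ℝ) (p := (2 : ℝ≥0∞)) (μ := μ) ENNReal.ofNat_ne_top
  -- (0) positive type against bounded measurable functions
  have hpt' : ∀ f : X → ℝ, Measurable f → ∀ B : ℝ, (∀ x, ‖f x‖ ≤ B) →
      0 ≤ ∫ x, ∫ y, f x * K x y * f y ∂μ ∂μ := by
    intro f hf B hB
    set B' := max B 1 with hB'
    have hB'0 : 0 < B' := lt_of_lt_of_le one_pos (le_max_right _ _)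
    have h := hpt (fun x => f x / B') (hf.div_const B') fun x => by
      rw [abs_div, abs_of_pos hB'0, div_le_one hB'0, ← Real.norm_eq_abs]
      exact (hB x).trans (le_max_left _ _)
    have he : ∫ x, ∫ y, f x / B' * K x y * (f y / B') ∂μ ∂μ =
        (∫ x, ∫ y, f x * K x y * f y ∂μ ∂μ) / B' ^ 2 := by
      rw [← integral_div]
      refine integral_congr_ae (Eventually.of_forall fun x => ?_)
      dsimp only
      rw [← integral_div]
      refine integral_congr_ae (Eventually.of_forall fun y => ?_)
      dsimp only
      rw [sq]
      field_simp
    rw [he] at h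
    have h' := mul_nonneg h (sq_nonneg B')
    rwa [div_mul_cancel₀ _ (pow_ne_zero 2 hB'0.ne')] at h'
  -- (1) density of simple functions
  refine hd.induction_on (p := fun φ => 0 ≤ ⟪φ, A φ⟫_ℝ) φ
    (isClosed_le continuous_const (continuous_id.inner A.continuous)) fun φs => ?_
  set f := Lp.simpleFunc.toSimpleFunc φs with hf_def
  have hf : (f : X → ℝ) =ᵐ[μ] ((φs : Lp ℝ 2 μ) : X → ℝ) := Lp.simpleFunc.toSimpleFunc_eq_toFun φs
  obtain ⟨B, hB⟩ := f.exists_forall_norm_le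
  have heq : ⟪(φs : Lp ℝ 2 μ), A (φs : Lp ℝ 2 μ)⟫_ℝ = ∫ x, ∫ y, f x * K x y * f y ∂μ ∂μ := by
    rw [inner_kernelOp_eq_integral hA]
    refine integral_congr_ae ?_
    filter_upwards [hf] with x hx
    rw [← hx, ← integral_const_mul]
    refine integral_congr_ae ?_
    filter_upwards [hf] with y hy
    rw [← hy]
    ring
  show 0 ≤ ⟪(φs : Lp ℝ 2 μ), A (φs : Lp ℝ 2 μ)⟫_ℝ
  rw [heq]
  exact hpt' f f.measurable B hB

end PositiveType

/-! ### Two spectral bookkeeping facts -/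

/-- If a self-adjoint bounded operator `T` with a Hilbert basis of eigenvectors `T bᵢ = λᵢ bᵢ` has an eigenvector `ψ ≠ 0`
for the eigenvalue `‖T‖`, then `‖T‖ = λᵢ` for some `i` (expand `ψ`; a coefficient `⟪bᵢ, ψ⟫ ≠ 0` forces `λᵢ = ‖T‖`).
[folklore] -/
theorem exists_index_eq_norm {E : Type*} [NormedAddCommGroup E] [InnerProductSpace ℝ E] [CompleteSpace E]
    {ι : Type*} (b : HilbertBasis ι ℝ E) {T : E →L[ℝ] E} (hT : IsSelfAdjoint T) {lam : ι → ℝ}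
    (hb : ∀ i, T (b i) = lam i • b i) {ψ : E} (hψ0 : ψ ≠ 0) (hψ : T ψ = ‖T‖ • ψ) : ∃ i, lam i = ‖T‖ := by
  by_contra h
  push Not at h
  have hcoef : ∀ i, ⟪b i, ψ⟫_ℝ = 0 := fun i => by
    have h1 : ⟪b i, T ψ⟫_ℝ = ‖T‖ * ⟪b i, ψ⟫_ℝ := by rw [hψ, real_inner_smul_right]
    have h2 : ⟪b i, T ψ⟫_ℝ = lam i * ⟪b i, ψ⟫_ℝ := by
      have hs := hT.isSymmetric (b i) ψ
      simp only [ContinuousLinearMap.coe_coe] at hs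
      rw [← hs, hb, real_inner_smul_left]
    have h3 : (lam i - ‖T‖) * ⟪b i, ψ⟫_ℝ = 0 := by rw [sub_mul, ← h2, ← h1, sub_self]
    exact (mul_eq_zero.1 h3).resolve_left (sub_ne_zero.2 (h i))
  apply hψ0
  have hr : b.repr ψ = 0 := lp.ext (funext fun i => by simp [HilbertBasis.repr_apply_apply, hcoef i])
  exact b.repr.injective (by rw [hr, map_zero])

/-- **Growth rate of the partition functions.**  If `Z(n+1) = Σᵢ λᵢ^{n+2}` for all `n` (here `Z m` stands for the
cyclic integral of `m + 1` kernels), with `0 ≤ λᵢ ≤ λ_{i₀}`, `0 < λ_{i₀}` and `Σ λᵢ² < ∞`, then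
`λ_{i₀}^{n+2} ≤ Z(n+1) ≤ λ_{i₀}^n Σλᵢ²`, so `Z(m)^{1/(m+1)} → λ_{i₀}` and the `limsup` is `λ_{i₀}`. [folklore] -/
theorem limsup_rpow_eq_of_hasSum_pow {ι : Type*} {lam : ι → ℝ} {i₀ : ι} (hlam0 : ∀ i, 0 ≤ lam i)
    (hle : ∀ i, lam i ≤ lam i₀) (hL0 : 0 < lam i₀) (hS : Summable fun i => lam i ^ 2) {Z : ℕ → ℝ}
    (hZ : ∀ n, HasSum (fun i => lam i ^ (n + 2)) (Z (n + 1))) :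
    limsup (fun m : ℕ => Z m ^ (((m : ℝ) + 1)⁻¹)) atTop = lam i₀ := by
  set L := lam i₀ with hL
  set S := ∑' i, lam i ^ 2 with hSdef
  have hS2 : HasSum (fun i => lam i ^ 2) S := hS.hasSum
  have hSL : L ^ 2 ≤ S := le_hasSum hS2 i₀ fun j _ => sq_nonneg _
  have hS0 : 0 < S := lt_of_lt_of_le (pow_pos hL0 2) hSL
  -- two-sided bounds `L^{n+2} ≤ Z(n+1) ≤ L^n S`
  have hlow : ∀ n, L ^ (n + 2) ≤ Z (n + 1) := fun n => le_hasSum (hZ n) i₀ fun j _ => pow_nonneg (hlam0 j) _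
  have hup : ∀ n, Z (n + 1) ≤ L ^ n * S := fun n =>
    hasSum_le (fun i => by
      rw [pow_add]
      exact mul_le_mul_of_nonneg_right (pow_le_pow_left₀ (hlam0 i) (hle i) n) (sq_nonneg _))
      (hZ n) (hS2.mul_left (L ^ n))
  have hZ0 : ∀ n, 0 ≤ Z (n + 1) := fun n => (pow_nonneg hL0.le _).trans (hlow n)
  have he : ∀ n : ℕ, (((n + 1 : ℕ) : ℝ) + 1)⁻¹ = ((n + 2 : ℕ) : ℝ)⁻¹ := fun n => by push_cast; ring
  -- the comparison sequences
  have h1 : Tendsto (fun n : ℕ => ((n + 2 : ℕ) : ℝ)⁻¹) atTop (𝓝 0) :=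
    tendsto_inv_atTop_zero.comp (tendsto_natCast_atTop_atTop.comp (tendsto_add_atTop_nat 2))
  have h2 : Tendsto (fun n : ℕ => (n : ℝ) * ((n + 2 : ℕ) : ℝ)⁻¹) atTop (𝓝 1) := by
    refine (tendsto_natCast_div_add_atTop (2 : ℝ)).congr' (Eventually.of_forall fun n => ?_)
    push_cast
    rw [div_eq_mul_inv]
  have hupper : Tendsto (fun n : ℕ => L ^ ((n : ℝ) * ((n + 2 : ℕ) : ℝ)⁻¹) * S ^ (((n + 2 : ℕ) : ℝ)⁻¹))
      atTop (𝓝 L) := by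
    have ha := (tendsto_const_nhds (x := L)).rpow h2 (Or.inl hL0.ne')
    have hb := (tendsto_const_nhds (x := S)).rpow h1 (Or.inl hS0.ne')
    rw [Real.rpow_one] at ha
    rw [Real.rpow_zero] at hb
    simpa using ha.mul hb
  have hmain : Tendsto (fun n : ℕ => Z (n + 1) ^ ((((n + 1 : ℕ) : ℝ) + 1)⁻¹)) atTop (𝓝 L) := by
    refine tendsto_of_tendsto_of_tendsto_of_le_of_le tendsto_const_nhds hupper (fun n => ?_) (fun n => ?_)
    · dsimp only
      rw [he n]
      calc L = (L ^ (n + 2)) ^ (((n + 2 : ℕ) : ℝ)⁻¹) := (Real.pow_rpow_inv_natCast hL0.le (by omega)).symm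
        _ ≤ Z (n + 1) ^ (((n + 2 : ℕ) : ℝ)⁻¹) := Real.rpow_le_rpow (pow_nonneg hL0.le _) (hlow n) (by positivity)
    · dsimp only
      rw [he n]
      calc Z (n + 1) ^ (((n + 2 : ℕ) : ℝ)⁻¹) ≤ (L ^ n * S) ^ (((n + 2 : ℕ) : ℝ)⁻¹) :=
            Real.rpow_le_rpow (hZ0 n) (hup n) (by positivity)
        _ = L ^ ((n : ℝ) * ((n + 2 : ℕ) : ℝ)⁻¹) * S ^ (((n + 2 : ℕ) : ℝ)⁻¹) := by
            rw [Real.mul_rpow (pow_nonneg hL0.le _) hS0.le, Real.rpow_mul hL0.le, Real.rpow_natCast]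
  exact ((tendsto_add_atTop_iff_nat 1).1 hmain).limsup_eq

end Literature.Analysis.OperatorTheory

end
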